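import Summits.CriticalPhenomena.SAWScalingLimit.Theorems.SAWDevelopingMapObservableToSLETypeLadderCarvedReductionSqueezeLimitCover
import HarnessLib

/-!
# The fat connectors of the limit cells (piece (T-A′₂F connectors) of stub T-A′₂F
# `stub_carvedReduction_squeezeGeometry_domainsCoreF`)

Crux `SAWDevelopingMap.ObservableToSLE` (stmt-CriticalPhenomena-10472), line `six-class-type-ladder`,
stub T-A′₂F `stub_carvedReduction_squeezeGeometry_domainsCoreF`.  Landing target:
`Summits/CriticalPhenomena/SAWScalingLimit/Theorems/SAWDevelopingMapObservableToSLETypeLadderCarvedReductionSqueezeConnectors.lean`.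

The swallowed zone of one side of the squeeze must be CONNECTED (its shrunken limit cells hang
on the spine core), which the limit cells alone do not provide (cells may touch only in the
limit).  By the fat clause of the carved level (`squeeze_limitPackage`), the centre of every cell
lies in a removed SOLID lattice hexagon containing a vertex `w` whose pinned position is within
`m = ρ/16` of the pinned spine.  `connector_limits` passes to ONE further subsequence along which
(`cells_limits_roots`, index type `Fin N ⊕ Fin N`: the fat hexagons and the dipping vertices as
degenerate cells) these fat hexagons converge to limit hexagons `Conn_a = hex(Cc a, ϱc a)` — the
CONNECTORS — with: shrunken connectors persistently removed, the cell centre `C a ∈ Conn_a`, the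
limit `W a ∈ Conn_a` of the dipping vertices, and `infDist (W a) K∞ ≤ m` for the Hausdorff limit
`K∞` of the pinned spines.
Registered carrier: `stub_carvedReduction_connectors`.
-/

noncomputable section

open scoped Topology
open Filter Set Metric
open Literature.Probability.LatticeModels (HexVertex hexGraph hexCenter triEmbed Site)
open Literature.Probability.RandomPlanarGeometry

namespace Summit.CriticalPhenomena.SAWScalingLimit.Theorems.ObservableToSLE.TypeLadder

open Summit.CriticalPhenomena.SAWScalingLimit.Theorems.ObservableToSLER.BridgeGate

/-- A closed skew-hexagon bound passes to the limit: if `|skewCoord ℓ (u j - C)| ≤ ϱ + ε` eventually,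
for every `ε > 0`, and `u j → z`, then `|skewCoord ℓ (z - C)| ≤ ϱ`. -/
theorem abs_skewCoord_le_of_tendsto {u : ℕ → ℂ} {z C : ℂ} {ϱ : ℝ} (ℓ : Fin 3) (hu : Tendsto u atTop (𝓝 z))
    (h : ∀ ε > (0 : ℝ), ∀ᶠ j in atTop, |skewCoord ℓ (u j - C)| ≤ ϱ + ε) : |skewCoord ℓ (z - C)| ≤ ϱ := by
  have hcont : Tendsto (fun j => |skewCoord ℓ (u j - C)|) atTop (𝓝 |skewCoord ℓ (z - C)|) :=
    ((continuous_abs.comp ((continuous_skewCoord ℓ).comp (continuous_id.sub continuous_const))).tendsto z).comp hu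
  refine le_of_forall_pos_le_add fun ε hε => ?_
  exact le_of_tendsto hcont (h ε hε)

/-- The distance to a Hausdorff limit of compact sets passes to the limit of points. -/
theorem infDist_le_of_tendsto {Kp : ℕ → Set ℂ} {Kinf : Set ℂ} {y : ℕ → ℂ} {y₀ : ℂ} {m : ℝ}
    (hKp : ∀ j, IsCompact (Kp j) ∧ (Kp j).Nonempty) (hKinf : IsCompact Kinf) (hne : Kinf.Nonempty)
    (hH : Tendsto (fun j => hausdorffDist (Kp j) Kinf) atTop (𝓝 0)) (hy : ∀ j, infDist (y j) (Kp j) ≤ m)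
    (hlim : Tendsto y atTop (𝓝 y₀)) : infDist y₀ Kinf ≤ m := by
  refine le_of_forall_pos_le_add fun ε hε => ?_
  have h1 : ∀ᶠ j in atTop, hausdorffDist (Kp j) Kinf < ε / 2 := (tendsto_order.1 hH).2 _ (half_pos hε)
  have h2 : ∀ᶠ j in atTop, dist (y j) y₀ < ε / 2 := (tendsto_iff_dist_tendsto_zero.1 hlim).eventually (gt_mem_nhds (half_pos hε))
  obtain ⟨j, hj1, hj2⟩ := (h1.and h2).exists
  have hfin := hausdorffEDist_ne_top_of_isCompact (hKp j).1 hKinf (hKp j).2 hne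
  calc infDist y₀ Kinf ≤ infDist (y j) Kinf + dist y₀ (y j) := infDist_le_infDist_add_dist
    _ ≤ (infDist (y j) (Kp j) + hausdorffDist (Kp j) Kinf) + dist y₀ (y j) :=
        add_le_add (infDist_le_infDist_add_hausdorffDist hfin) le_rfl
    _ ≤ m + ε := by rw [dist_comm] at hj2; linarith [hy j]

/-- **THE CONNECTORS**; see the module docstring.  Data of one side: meshes `s j > 0`, `s j → 0`,
pinning vector `τ j`, removed levels `L j` (`R`-local about `root j`, pinned roots `→ ℓ₀`), the
cells `g j i` with removed centres whose pinned positions converge to `C i`, the fat clause with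
dipping distance `m` to the pinned spines `Kp j` (compact nonempty, Hausdorff-converging to the
compact nonempty `K∞`). -/
theorem connector_limits {N : ℕ} {s : ℕ → ℝ} {τ : ℕ → ℂ} {L : ℕ → Set HexVertex} {root : ℕ → HexVertex}
    {g : ℕ → Fin N → HexVertex × ℕ} {Kp : ℕ → Set ℂ} {Kinf : Set ℂ} {C : Fin N → ℂ} {R m : ℝ} {ℓ₀ : ℂ}
    (hs : ∀ j, 0 < s j) (hs0 : Tendsto s atTop (𝓝 0))
    (hloc : ∀ j, ∀ v ∈ L j, dist ((s j : ℂ) * hexCenter v) ((s j : ℂ) * hexCenter (root j)) ≤ R)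
    (hroot : Tendsto (fun j => (s j : ℂ) * hexCenter (root j) - τ j) atTop (𝓝 ℓ₀))
    (hcell : ∀ j i, (g j i).1 ∈ L j)
    (hC : ∀ i, Tendsto (fun j => (s j : ℂ) * hexCenter (g j i).1 - τ j) atTop (𝓝 (C i)))
    (hfat : ∀ j, ∀ v ∈ L j, ∃ (t w : HexVertex) (r : ℕ), v ∈ hexBall t r ∧ w ∈ hexBall t r ∧ hexBall t r ⊆ L j ∧
      infDist ((s j : ℂ) * hexCenter w - τ j) (Kp j) ≤ m)
    (hKp : ∀ j, IsCompact (Kp j) ∧ (Kp j).Nonempty) (hKinf : IsCompact Kinf) (hKne : Kinf.Nonempty)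
    (hH : Tendsto (fun j => hausdorffDist (Kp j) Kinf) atTop (𝓝 0)) :
    ∃ (ψ : ℕ → ℕ) (Cc W : Fin N → ℂ) (ϱc : Fin N → ℝ), StrictMono ψ ∧ (∀ i, 0 ≤ ϱc i) ∧
      (∀ i (ℓ : Fin 3), |skewCoord ℓ (C i - Cc i)| ≤ ϱc i) ∧
      (∀ i (ℓ : Fin 3), |skewCoord ℓ (W i - Cc i)| ≤ ϱc i) ∧
      (∀ i, infDist (W i) Kinf ≤ m) ∧
      (∀ ε > (0 : ℝ), ∀ᶠ j in atTop, ∀ (i : Fin N) (v : HexVertex),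
        (∀ ℓ : Fin 3, |skewCoord ℓ ((s (ψ j) : ℂ) * hexCenter v - τ (ψ j) - Cc i)| ≤ ϱc i - ε) → v ∈ L (ψ j)) := by
  classical
  -- the fat hexagon and the dipping vertex of each cell centre
  have hfat' : ∀ j i, ∃ (t w : HexVertex) (r : ℕ), (g j i).1 ∈ hexBall t r ∧ w ∈ hexBall t r ∧ hexBall t r ⊆ L j ∧
      infDist ((s j : ℂ) * hexCenter w - τ j) (Kp j) ≤ m := fun j i => hfat j _ (hcell j i)
  choose t w r ht hw hsub hdist using hfat'
  -- one family of cells indexed by `Fin N ⊕ Fin N`: fat hexagons and degenerate dipping cells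
  set G : ℕ → (Fin N ⊕ Fin N) → HexVertex × ℕ := fun j => Sum.elim (fun i => (t j i, r j i)) (fun i => (w j i, 0)) with hG
  have hGl : ∀ j i, G j (Sum.inl i) = (t j i, r j i) := fun j i => rfl
  have hGr : ∀ j i, G j (Sum.inr i) = (w j i, 0) := fun j i => rfl
  have hGsub : ∀ j i, hexBall (G j i).1 (G j i).2 ⊆ L j := by
    intro j i
    rcases i with i | i
    · rw [hGl]; exact hsub j i
    · rw [hGr]; intro v hv
      rw [mem_hexBall_zero_iff] at hv
      rw [hv]; exact hsub j i (hw j i)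
  have hloc' : ∀ j i, ∀ v ∈ hexBall (G j i).1 (G j i).2,
      dist ((s j : ℂ) * hexCenter v) ((s j : ℂ) * hexCenter (root j)) ≤ R := fun j i v hv => hloc j v (hGsub j i hv)
  obtain ⟨ψ, C', ϱ', hψ, hϱ0, -, hconv, -, hper, hcont, -⟩ :=
    cells_limits_roots (ι := Fin N ⊕ Fin N) (root := fun j _ => root j) (ℓ₀ := fun _ => ℓ₀) hs hs0 hloc' (fun _ => hroot)
  refine ⟨ψ, fun i => C' (Sum.inl i), fun i => C' (Sum.inr i), fun i => ϱ' (Sum.inl i), hψ, fun i => hϱ0 _, ?_, ?_, ?_, ?_⟩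
  · -- the cell centre lies in its connector
    intro i ℓ
    refine abs_skewCoord_le_of_tendsto ℓ ((hC i).comp hψ.tendsto_atTop) fun ε hε => ?_
    filter_upwards [hcont ε hε] with j hj
    have := hj (Sum.inl i) (g (ψ j) i).1 (by rw [hGl]; exact ht (ψ j) i) ℓ
    simpa using this
  · -- the limit of the dipping vertices lies in the connector
    intro i ℓ
    have hWlim : Tendsto (fun j => (s (ψ j) : ℂ) * hexCenter (w (ψ j) i) - τ (ψ j)) atTop (𝓝 (C' (Sum.inr i))) := by
      have := hconv (Sum.inr i); simpa [hGr] using this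
    refine abs_skewCoord_le_of_tendsto ℓ hWlim fun ε hε => ?_
    filter_upwards [hcont ε hε] with j hj
    have := hj (Sum.inl i) (w (ψ j) i) (by rw [hGl]; exact hw (ψ j) i) ℓ
    simpa using this
  · -- the dipping distance passes to the limit
    intro i
    have hWlim : Tendsto (fun j => (s (ψ j) : ℂ) * hexCenter (w (ψ j) i) - τ (ψ j)) atTop (𝓝 (C' (Sum.inr i))) := by
      have := hconv (Sum.inr i); simpa [hGr] using this
    exact infDist_le_of_tendsto (fun j => hKp (ψ j)) hKinf hKne (hH.comp hψ.tendsto_atTop) (fun j => hdist (ψ j) i) hWlim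
  · -- persistence of the shrunken connectors
    intro ε hε
    filter_upwards [hper ε hε] with j hj i v hv
    exact hsub (ψ j) i (by have := hj (Sum.inl i) v hv; rwa [hGl] at this)

/-- **Registered carrier `stub_carvedReduction_connectors`** (crux item stmt-CriticalPhenomena-10472,
stub T-A′₂F `stub_carvedReduction_squeezeGeometry_domainsCoreF`, piece THE CONNECTORS): a closed
skew-hexagon bound passes to the limit. -/
theorem stub_carvedReduction_connectors :
    ∀ (u : ℕ → ℂ) (z C : ℂ) (ϱ : ℝ) (ℓ : Fin 3), Tendsto u atTop (𝓝 z) →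
      (∀ ε > (0 : ℝ), ∀ᶠ j in atTop, |skewCoord ℓ (u j - C)| ≤ ϱ + ε) → |skewCoord ℓ (z - C)| ≤ ϱ :=
  fun _ _ _ _ ℓ hu h => abs_skewCoord_le_of_tendsto ℓ hu h

end Summit.CriticalPhenomena.SAWScalingLimit.Theorems.ObservableToSLE.TypeLadder

end
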